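import Summits.ResolutionOfSingularities.ResolutionOfSingularities.Theorems.HilbertSamuelEliminationCampaignW42TertiaryReduction
import Mathlib.SetTheory.Ordinal.Family
import HarnessLib

/-!
# [OURS · L1 W4.2] Genuine steps: the lax tertiary-invariant slot is a faithful reformulation of the pure grade —
# sorry-free reductions for the REFINED campaign statements of `HilbertSamuelEliminationCampaignW42Tertiary.lean`
# (informal crux `TertiaryTermination`, stmt-ResolutionOfSingularities-17846; `--supports stmt-…-17846`)

OURS (slot W4.2, prover seat res-L1-s42-pv-2); NOT statements of H. Hironaka's manuscript; AI review is weaker than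
expert review. Continues `…CampaignW42TertiaryReduction.lean` for the refined decls `CampaignW42.{MarkedStage.IsBlownUp,
NoMovingNearChainFrom, NoWaitingChainFrom, TertiaryTerminationMovingAt, StratumLiveness, TertiaryInvariantLax,
TertiaryInvariantLaxExists}` (genuine steps = the marked point lies in the centre; waiting steps = blow-up an
isomorphism near it). PROVED here:

* `GradeStep`, `GenuinePath`, `concatCoord`/`concatSeq` (concatenating countably many
  finite paths), `noMovingNearChainFrom_of_lax` (a LAX invariant — non-increasing, dropping at genuine steps — excludes
  chains blown up infinitely often: the least value along the chain would be undercut), `wellFounded_movingRel` /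
  `TertiaryInvariantLax.ofMovingAt` (conversely the rank of «reached through a genuine step» is a lax invariant),
  `tertiaryInvariantLaxExists_iff : TertiaryInvariantLaxExists p e ↔ TertiaryTerminationMovingAt p e`,
  `tertiaryTerminationMovingAt_of_terminationAt`, `TertiaryInvariant.toLax`, `stratumLiveness_of_tertiaryTermination`,
  `tertiaryTermination_of_moving_of_liveness` (all moving grades + liveness + `ē`-monotonicity ⇒ ungraded).

## References

* V. Cossart, U. Jannsen, S. Saito, LNM 2270 (2020), Rem. 6.29 (1), Def. 6.34/6.38, Thm. 6.35/6.40, p. 107.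
  [CossartJannsenSaito2020]
* V. Cossart, B. Schober, Publ. RIMS 56 (2020), Thm. 1 (`ι(x′) < ι(x)` for `x` in the centre, `x′` over `x`).
  [CossartSchober2020]
-/

noncomputable section

set_option linter.dupNamespace false -- mandated namespace of this single-conjunct summit

open CategoryTheory AlgebraicGeometry TopologicalSpace

namespace Summit.ResolutionOfSingularities.ResolutionOfSingularities.Theorems

namespace CampaignW42

open Literature.AlgebraicGeometry.Resolution

universe u v

variable {p : ℕ} {R : ∀ S : Scheme.{u}, CentreSeq S → Prop} {N : ℕ} {ν : ℕ → ℕ}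

/-! ## Refinement: genuine steps (`IsBlownUp`), the lax slot, liveness -/

/-- A GRADE-`e` STEP: a canonical near step between marked stages of geometric directrix dimension `e`. [folklore] -/
def GradeStep (R : ∀ S : Scheme.{u}, CentreSeq S → Prop) (N : ℕ) (ν : ℕ → ℕ) (e : ℕ)
    (s s' : MarkedStage.{u}) : Prop :=
  CanonicalNearStep R N ν s s' ∧ s.geomDirDim = e ∧ s'.geomDirDim = e

/-- A FINITE GRADE-`e` PATH from `s` to `s'` THROUGH AT LEAST ONE GENUINE STEP (a step taken at a marked stage whose
marked point is blown up), rendered with an `ℕ`-indexed function and a length. [folklore] -/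
def GenuinePath (R : ∀ S : Scheme.{u}, CentreSeq S → Prop) (N : ℕ) (ν : ℕ → ℕ) (e : ℕ)
    (s s' : MarkedStage.{u}) : Prop :=
  ∃ (ℓ : ℕ) (g : ℕ → MarkedStage.{u}), g 0 = s ∧ g ℓ = s' ∧
    (∀ i, i < ℓ → GradeStep R N ν e (g i) (g (i + 1))) ∧ ∃ i, i < ℓ ∧ (g i).IsBlownUp R N ν

/-- A single genuine grade-`e` step is a genuine path. [folklore] -/
theorem genuinePath_single {e : ℕ} {s s' : MarkedStage.{u}} (h : GradeStep R N ν e s s')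
    (hb : s.IsBlownUp R N ν) : GenuinePath R N ν e s s' := by
  refine ⟨1, fun i => if i = 0 then s else s', by simp, by simp, ?_, ⟨0, Nat.zero_lt_one, by simpa using hb⟩⟩
  intro i hi
  obtain rfl : i = 0 := by omega
  simpa using h

/-- Prepending a grade-`e` step to a genuine path gives a genuine path. [folklore] -/
theorem GenuinePath.cons {e : ℕ} {s s' s'' : MarkedStage.{u}} (h : GradeStep R N ν e s s')
    (hp : GenuinePath R N ν e s' s'') : GenuinePath R N ν e s s'' := by
  obtain ⟨ℓ, g, hg0, hgℓ, hstep, i, hi, hbi⟩ := hp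
  refine ⟨ℓ + 1, fun j => if j = 0 then s else g (j - 1), by simp, by simpa using hgℓ, ?_,
    ⟨i + 1, by omega, by simpa using hbi⟩⟩
  intro j hj
  rcases j with _ | j
  · simpa [hg0] using h
  · have : j < ℓ := by omega
    simpa using hstep j this

/-! ### Concatenating countably many finite paths -/

section Concat

variable {α : Type*} (len : ℕ → ℕ)

/-- Block coordinates `(n, i)` of the `k`-th term of the concatenation of blocks of lengths `len 0, len 1, …`
(the last point of each block being the first point of the next). [folklore] -/
def concatCoord : ℕ → ℕ × ℕ
  | 0 => (0, 0)
  | k + 1 =>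
    if (concatCoord k).2 + 1 < len (concatCoord k).1 then ((concatCoord k).1, (concatCoord k).2 + 1)
    else ((concatCoord k).1 + 1, 0)

/-- The concatenated sequence. [folklore] -/
def concatSeq (gs : ℕ → ℕ → α) (k : ℕ) : α :=
  gs (concatCoord len k).1 (concatCoord len k).2

variable {len}

/-- Inside each block the position stays below the block length. [folklore] -/
theorem concatCoord_snd_lt (hlen : ∀ n, 0 < len n) (k : ℕ) :
    (concatCoord len k).2 < len (concatCoord len k).1 := by
  induction k with
  | zero => exact hlen 0
  | succ k ih =>
    simp only [concatCoord]
    split_ifs with h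
    · exact h
    · exact hlen _

/-- The successor term is the next point of the current block (using the compatibility of consecutive blocks at
their ends). [folklore] -/
theorem concatSeq_succ {gs : ℕ → ℕ → α} (hlen : ∀ n, 0 < len n)
    (hcompat : ∀ n, gs n (len n) = gs (n + 1) 0) (k : ℕ) :
    concatSeq len gs (k + 1) = gs (concatCoord len k).1 ((concatCoord len k).2 + 1) := by
  have hlt := concatCoord_snd_lt hlen k
  simp only [concatSeq, concatCoord]
  split_ifs with h
  · rfl
  · have heq : (concatCoord len k).2 + 1 = len (concatCoord len k).1 := by omega
    rw [← hcompat, heq]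

/-- A relation holding inside every block holds along the concatenation. [folklore] -/
theorem rel_concatSeq {gs : ℕ → ℕ → α} {r : α → α → Prop} (hlen : ∀ n, 0 < len n)
    (hcompat : ∀ n, gs n (len n) = gs (n + 1) 0) (hrel : ∀ n i, i < len n → r (gs n i) (gs n (i + 1)))
    (k : ℕ) : r (concatSeq len gs k) (concatSeq len gs (k + 1)) := by
  rw [concatSeq_succ hlen hcompat k]
  exact hrel _ _ (concatCoord_snd_lt hlen k)

/-- Every position of every block is visited, at an index at least the block number. [folklore] -/
theorem exists_concatCoord_eq (hlen : ∀ n, 0 < len n) (n i : ℕ) (hi : i < len n) :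
    ∃ k, n ≤ k ∧ concatCoord len k = (n, i) := by
  have hstart : ∀ n, ∃ k, n ≤ k ∧ concatCoord len k = (n, 0) := by
    intro n
    induction n with
    | zero => exact ⟨0, le_rfl, rfl⟩
    | succ n ih =>
      obtain ⟨k, hk, hcoord⟩ := ih
      have hblock : ∀ j, j < len n → concatCoord len (k + j) = (n, j) := by
        intro j hj
        induction j with
        | zero => simpa using hcoord
        | succ j ihj =>
          have hj' : j < len n := by omega
          have := ihj hj'
          show concatCoord len (k + j + 1) = (n, j + 1)
          simp only [concatCoord, this]
          rw [if_pos hj]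
      refine ⟨k + (len n - 1) + 1, by omega, ?_⟩
      have hlast := hblock (len n - 1) (by have := hlen n; omega)
      simp only [concatCoord, hlast]
      rw [if_neg (by have := hlen n; omega)]
  obtain ⟨k, hk, hcoord⟩ := hstart n
  have hblock : ∀ j, j < len n → concatCoord len (k + j) = (n, j) := by
    intro j hj
    induction j with
    | zero => simpa using hcoord
    | succ j ihj =>
      have hj' : j < len n := by omega
      have := ihj hj'
      show concatCoord len (k + j + 1) = (n, j + 1)
      simp only [concatCoord, this]
      rw [if_pos hj]
  exact ⟨k + i, by omega, hblock i hi⟩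

end Concat

/-! ### The lax slot proves the moving grade; the moving grade yields a lax invariant -/

/-- `NoNearChainFrom` implies `NoMovingNearChainFrom` (fewer chains are excluded by the latter). [folklore] -/
theorem NoNearChainFrom.noMoving {s₀ : MarkedStage.{u}} {G : MarkedStage.{u} → Prop}
    (h : NoNearChainFrom R N ν s₀ G) : NoMovingNearChainFrom R N ν s₀ G := by
  rintro ⟨c, h0, hstep, hG, -⟩
  exact h ⟨c, h0, hstep, hG⟩

/-- `TertiaryTerminationAt p e → TertiaryTerminationMovingAt p e`. [folklore] -/
theorem tertiaryTerminationMovingAt_of_terminationAt {e : ℕ} (h : TertiaryTerminationAt.{u} p e) :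
    TertiaryTerminationMovingAt.{u} p e :=
  fun R hRf hRa N ν X _ x hX => (h R hRf hRa N ν X x hX).noMoving

/-- A (strict) tertiary invariant is a lax one. [folklore] -/
def TertiaryInvariant.toLax {e : ℕ} (T : TertiaryInvariant.{u, v} p R N ν e) :
    TertiaryInvariantLax.{u, v} p R N ν e where
  ι := T.ι
  pre := T.pre
  wf := T.wf
  τ := T.τ
  mono := fun s s' hs hst hse hs'e => by
    letI : Preorder T.ι := T.pre
    exact le_of_lt (T.decr s s' hs hst hse hs'e)
  decr := fun s s' hs hst hse hs'e _ => T.decr s s' hs hst hse hs'e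

/-- `TertiaryInvariantExists p e → TertiaryInvariantLaxExists p e`. [folklore] -/
theorem tertiaryInvariantLaxExists_of_exists {e : ℕ} (h : TertiaryInvariantExists.{u, v} p e) :
    TertiaryInvariantLaxExists.{u, v} p e :=
  fun R hRf hRa N ν => (h R hRf hRa N ν).map TertiaryInvariant.toLax

/-- **A LAX TERTIARY INVARIANT AT GRADE `e` EXCLUDES INFINITE MOVING NEAR CHAINS OF GRADE `e`**: along such a chain `τ`
never increases and drops infinitely often, impossible in a well-founded order (the least value of `τ` along the chain
would be undercut at the next genuine step). [folklore] -/
theorem noMovingNearChainFrom_of_lax {e : ℕ} (T : TertiaryInvariantLax.{u, v} p R N ν e)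
    {X : Scheme.{u}} [IsLocallyNoetherian X] {x : X} (hX : IsIsolatedOrigin p N ν X x) :
    NoMovingNearChainFrom R N ν (MarkedStage.init X x) fun s => s.geomDirDim = e := by
  rintro ⟨c, h0, hstep, hgrade, hblown⟩
  have hsc : ∀ n, InScope p R N ν (c n) :=
    InScope.chain ((InScope.init hX).of_reaches h0) hstep
  letI : Preorder T.ι := T.pre
  haveI : WellFoundedLT T.ι := T.wf
  have hmono : ∀ n, T.τ (c (n + 1)) ≤ T.τ (c n) := fun n =>
    T.mono (c n) (c (n + 1)) (hsc n) (hstep n) (hgrade n) (hgrade (n + 1))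
  have hanti : Antitone fun n => T.τ (c n) := antitone_nat_of_succ_le hmono
  obtain ⟨a, ⟨n₀, rfl⟩, hmin⟩ :=
    (wellFounded_lt (α := T.ι)).has_min (Set.range fun n => T.τ (c n)) ⟨_, 0, rfl⟩
  obtain ⟨m, hm, hbm⟩ := hblown n₀
  have hlt : T.τ (c (m + 1)) < T.τ (c m) :=
    T.decr (c m) (c (m + 1)) (hsc m) (hstep m) (hgrade m) (hgrade (m + 1)) hbm
  exact hmin _ ⟨m + 1, rfl⟩ (hlt.trans_le (hanti hm))

/-- **`TertiaryInvariantLaxExists p e → TertiaryTerminationMovingAt p e`.** [folklore] -/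
theorem tertiaryTerminationMovingAt_of_laxExists {e : ℕ} (h : TertiaryInvariantLaxExists.{u, v} p e) :
    TertiaryTerminationMovingAt.{u} p e := by
  intro R hRf hRa N ν X _ x hX
  obtain ⟨T⟩ := h R hRf hRa N ν
  exact noMovingNearChainFrom_of_lax T hX

/-- THE MOVING RELATION at grade `e`, transposed: `movingRel e s' s` iff `s` is in scope and `s'` is reached from `s`
along a finite grade-`e` path through at least one genuine step. [folklore] -/
def movingRel (p : ℕ) (R : ∀ S : Scheme.{u}, CentreSeq S → Prop) (N : ℕ) (ν : ℕ → ℕ) (e : ℕ)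
    (s' s : MarkedStage.{u}) : Prop :=
  InScope p R N ν s ∧ GenuinePath R N ν e s s'

/-- **The moving grade-`e` key theorem makes `movingRel e` WELL-FOUNDED**: a descending chain of genuine paths
concatenates (`concatSeq`) to an infinite grade-`e` near chain from an in-scope start whose marked point is blown up
infinitely often. [folklore] -/
theorem wellFounded_movingRel {e : ℕ}
    (h : ∀ (X : Scheme.{u}) [IsLocallyNoetherian X] (x : X), IsIsolatedOrigin p N ν X x →
      NoMovingNearChainFrom R N ν (MarkedStage.init X x) fun s => s.geomDirDim = e) :
    WellFounded (movingRel p R N ν e) := by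
  refine wellFounded_iff_isEmpty_descending_chain.mpr ⟨fun ⟨f, hf⟩ => ?_⟩
  obtain ⟨X, hX, x, horig, hreach⟩ := (hf 0).1
  choose len gs hg0 hgℓ hgs hblown using fun n => (hf n).2
  have hlen : ∀ n, 0 < len n := fun n => by obtain ⟨i, hi, -⟩ := hblown n; omega
  have hcompat : ∀ n, gs n (len n) = gs (n + 1) 0 := fun n => by rw [hgℓ, hg0]
  refine @h X hX x horig ⟨concatSeq len gs, ?_, ?_, ?_, ?_⟩
  · show Reaches R N ν _ (gs 0 0)
    rw [hg0]; exact hreach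
  · exact fun k => (rel_concatSeq hlen hcompat (fun n i hi => hgs n i hi) k).1
  · intro k
    exact (hgs _ _ (concatCoord_snd_lt hlen k)).2.1
  · intro n
    obtain ⟨i, hi, hbi⟩ := hblown n
    obtain ⟨k, hk, hcoord⟩ := exists_concatCoord_eq hlen n i hi
    refine ⟨k, hk, ?_⟩
    show (gs (concatCoord len k).1 (concatCoord len k).2).IsBlownUp R N ν
    rw [hcoord]; exact hbi

/-- Along a grade-`e` step from an in-scope marked stage the `movingRel`-rank does not increase: every genuine path
from `s'` extends backwards to a genuine path from `s`. [folklore] -/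
theorem rank_movingRel_le_of_step {e : ℕ} [IsWellFounded MarkedStage.{u} (movingRel p R N ν e)]
    {s s' : MarkedStage.{u}} (hs : InScope p R N ν s) (h : GradeStep R N ν e s s') :
    IsWellFounded.rank (movingRel p R N ν e) s' ≤ IsWellFounded.rank (movingRel p R N ν e) s := by
  rw [IsWellFounded.rank_eq (movingRel p R N ν e) s']
  refine Ordinal.iSup_le fun b => ?_
  exact Order.succ_le_of_lt (IsWellFounded.rank_lt_of_rel (r := movingRel p R N ν e) ⟨hs, b.2.2.cons h⟩)

/-- **THE RANK INVARIANT (lax)**: from the moving grade-`e` key theorem, the well-founded rank of `movingRel e` is a LAX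
tertiary invariant at grade `e` (values in `Ordinal`): non-increasing along grade-`e` steps, strictly decreasing at
genuine ones. [folklore] -/
def TertiaryInvariantLax.ofMovingAt {e : ℕ}
    (h : ∀ (X : Scheme.{u}) [IsLocallyNoetherian X] (x : X), IsIsolatedOrigin p N ν X x →
      NoMovingNearChainFrom R N ν (MarkedStage.init X x) fun s => s.geomDirDim = e) :
    TertiaryInvariantLax.{u, u + 2} p R N ν e :=
  haveI : IsWellFounded MarkedStage.{u} (movingRel p R N ν e) := ⟨wellFounded_movingRel h⟩
  { ι := Ordinal.{u + 1}
    pre := inferInstance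
    wf := inferInstance
    τ := IsWellFounded.rank (movingRel p R N ν e)
    mono := fun _ _ hs hst hse hs'e => rank_movingRel_le_of_step hs ⟨hst, hse, hs'e⟩
    decr := fun _ _ hs hst hse hs'e hb =>
      IsWellFounded.rank_lt_of_rel (r := movingRel p R N ν e) ⟨hs, genuinePath_single ⟨hst, hse, hs'e⟩ hb⟩ }

/-- **`TertiaryTerminationMovingAt p e → TertiaryInvariantLaxExists p e`** (values in `Ordinal.{u+1}`). [folklore] -/
theorem tertiaryInvariantLaxExists_of_movingAt {e : ℕ} (h : TertiaryTerminationMovingAt.{u} p e) :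
    TertiaryInvariantLaxExists.{u, u + 2} p e :=
  fun R hRf hRa N ν => ⟨TertiaryInvariantLax.ofMovingAt fun X _ x hX => h R hRf hRa N ν X x hX⟩

/-- **THE LAX SLOT IS A FAITHFUL REFORMULATION OF THE PURE GRADE: `TertiaryInvariantLaxExists p e ↔
TertiaryTerminationMovingAt p e`** (value universe large enough for `Ordinal.{u+1}`; `→` holds in every value universe).
[folklore] -/
theorem tertiaryInvariantLaxExists_iff {e : ℕ} :
    TertiaryInvariantLaxExists.{u, u + 2} p e ↔ TertiaryTerminationMovingAt.{u} p e :=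
  ⟨tertiaryTerminationMovingAt_of_laxExists, tertiaryInvariantLaxExists_of_movingAt⟩

/-! ### Liveness and the ungraded statement -/

/-- The ungraded statement implies stratum liveness. [folklore] -/
theorem stratumLiveness_of_tertiaryTermination (h : TertiaryTermination.{u} p) : StratumLiveness.{u} p := by
  intro R hRf hRa N ν X _ x hX
  rintro ⟨c, h0, hstep, -⟩
  exact h R hRf hRa N ν X x hX ⟨c, h0, hstep, fun _ => trivial⟩

/-- **ASSEMBLY (refined)**: the moving graded key theorems for all grades, stratum liveness, and the monotonicity of
`ē` give the ungraded statement — an infinite chain is either blown up infinitely often (then its tail inside the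
eventual grade is a moving chain) or eventually waits for ever (excluded by liveness, applied to the tail). [folklore] -/
theorem tertiaryTermination_of_moving_of_liveness (hmono : GeomDirDimNonincrease.{u} p)
    (hlive : StratumLiveness.{u} p) (h : ∀ e, TertiaryTerminationMovingAt.{u} p e) :
    TertiaryTermination.{u} p := by
  intro R hRf hRa N ν X _ x hX
  rintro ⟨c, h0, hstep, -⟩
  have hsc : ∀ n, InScope p R N ν (c n) :=
    InScope.chain ((InScope.init hX).of_reaches h0) hstep
  by_cases hinf : ∀ n, ∃ m, n ≤ m ∧ (c m).IsBlownUp R N ν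
  · have hg : ∀ n, (c (n + 1)).geomDirDim ≤ (c n).geomDirDim := fun n =>
      hmono R hRf hRa N ν (c n) (c (n + 1)) (hsc n) (hstep n)
    obtain ⟨n₀, hn₀⟩ := eventually_const_of_succ_le (g := fun n => (c n).geomDirDim) hg
    refine h (c n₀).geomDirDim R hRf hRa N ν X x hX ⟨fun n => c (n₀ + n), ?_, ?_, ?_, ?_⟩
    · exact reaches_chain h0 hstep n₀
    · exact fun n => hstep (n₀ + n)
    · exact fun n => hn₀ n
    · intro n
      obtain ⟨m, hm, hbm⟩ := hinf (n₀ + n)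
      refine ⟨m - n₀, by omega, ?_⟩
      have : n₀ + (m - n₀) = m := by omega
      show (c (n₀ + (m - n₀))).IsBlownUp R N ν
      rw [this]; exact hbm
  · simp only [not_forall, not_exists, not_and] at hinf
    obtain ⟨n₀, hn₀⟩ := hinf
    refine hlive R hRf hRa N ν X x hX ⟨fun n => c (n₀ + n), ?_, ?_, ?_⟩
    · exact reaches_chain h0 hstep n₀
    · exact fun n => hstep (n₀ + n)
    · exact fun n => hn₀ (n₀ + n) (Nat.le_add_right _ _)

end CampaignW42

end Summit.ResolutionOfSingularities.ResolutionOfSingularities.Theorems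

end
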